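import Summits.NavierStokesRegularity.NavierStokesRegularity.Theorems.ExtremiserTransienceNearExtremalTransienceExtremiserLiouvilleConstantSpeedCalculus
import HarnessLib

/-!
# Crux `ExtremiserTransience.NearExtremalTransience` (stmt-NavierStokesRegularity-21883), line `extremiser_liouville`,
# stub K1b — backward quotients of the LAYER PROFILE: `h⁻¹(g(s) − g(s−h)) → g′(s)` uniformly, and the weighted
# integrals converge (record §13, R4 tool)

`--supports stmt-NavierStokesRegularity-21883` (helper).  Author: prover seat `ns-el-k1b` (g8).
In the palinstrophy bound (R3) the weight `D₋ₕg(x₂) = h⁻¹(g(x₂) − g(x₂−h))` multiplies `|Dω|²_F ∈ L¹`; its limit is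
`∫g′(x₂)|Dω|²_F`.  Elementary tools:
* `abs_backwardQuotient_sub_deriv_le` : `|h⁻¹(g(s) − g(s−h)) − g′(s)| ≤ K₂h` for `g ∈ C²`, `|g″| ≤ K₂`, `h > 0`;
* `abs_integral_backwardQuotient_weight_sub_le` : `|∫h⁻¹(g(x₂) − g(x₂−h))ρ − ∫g′(x₂)ρ| ≤ K₂h∫|ρ|` for `ρ ∈ L¹`;
* `tendsto_integral_backwardQuotient_weight` : hence `∫h⁻¹(g(x₂) − g(x₂−h))ρ(x)dx → ∫g′(x₂)ρ(x)dx` as `h → 0⁺`.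

WHAT THIS IS NOT: K1b is NOT proved; nothing here proves NS regularity. [folklore]
-/

noncomputable section

open Set Filter Topology MeasureTheory Metric Function InnerProductSpace
open scoped ENNReal NNReal Topology InnerProductSpace RealInnerProductSpace ContDiff
open Literature.Analysis.FluidPDE Literature.Analysis

namespace Summit.NavierStokesRegularity.NavierStokesRegularity.Theorems

-- the problem directory repeats the summit name (`NavierStokesRegularity/NavierStokesRegularity`)
set_option linter.dupNamespace false

namespace ExtremiserLiouville

variable {g : ℝ → ℝ} {ρ : EuclideanSpace ℝ (Fin 3) → ℝ}

/-- **`|h⁻¹(g(s) − g(s−h)) − g′(s)| ≤ K₂h`** for `g ∈ C²` with `|g″| ≤ K₂` and `h > 0`. [folklore] -/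
theorem abs_backwardQuotient_sub_deriv_le (hg : ContDiff ℝ 2 g) {K2 : ℝ} (hK2 : ∀ s, |deriv (deriv g) s| ≤ K2)
    {h : ℝ} (hh : 0 < h) (s : ℝ) : |h⁻¹ * (g s - g (s - h)) - deriv g s| ≤ K2 * h := by
  have hgd : Differentiable ℝ g := hg.differentiable two_ne_zero
  have hg'c : ContDiff ℝ 1 (deriv g) := by
    have h2 : ContDiff ℝ (1 + 1) g := by rw [show ((1 : WithTop ℕ∞) + 1) = 2 by norm_num]; exact hg
    exact h2.deriv'
  have hg'd : Differentiable ℝ (deriv g) := hg'c.differentiable one_ne_zero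
  have hg'cont : Continuous (deriv g) := hg'c.continuous
  have hg''cont : Continuous (deriv (deriv g)) := (contDiff_one_iff_deriv.1 hg'c).2
  -- `g(s) − g(s−h) = ∫_{s−h}^{s} g′`
  have hftc : ∫ t in (s - h)..s, deriv g t = g s - g (s - h) :=
    intervalIntegral.integral_eq_sub_of_hasDerivAt (fun t _ => (hgd t).hasDerivAt) (hg'cont.intervalIntegrable _ _)
  -- `|g′(t) − g′(s)| ≤ K₂|t − s|`
  have hlip : ∀ t, |deriv g t - deriv g s| ≤ K2 * |t - s| := by
    intro t
    have h1 : ∫ u in s..t, deriv (deriv g) u = deriv g t - deriv g s :=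
      intervalIntegral.integral_eq_sub_of_hasDerivAt (fun u _ => (hg'd u).hasDerivAt) (hg''cont.intervalIntegrable _ _)
    rw [← h1]
    have := intervalIntegral.norm_integral_le_of_norm_le_const (a := s) (b := t) (C := K2) (f := fun u => deriv (deriv g) u)
      fun u _ => by rw [Real.norm_eq_abs]; exact hK2 u
    rw [Real.norm_eq_abs] at this
    exact this
  have hconst : ∫ _t in (s - h)..s, deriv g s = h * deriv g s := by
    rw [intervalIntegral.integral_const, smul_eq_mul]; ring
  have hdiff : h⁻¹ * (g s - g (s - h)) - deriv g s = h⁻¹ * ∫ t in (s - h)..s, (deriv g t - deriv g s) := by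
    rw [intervalIntegral.integral_sub (hg'cont.intervalIntegrable _ _) intervalIntegrable_const, hftc, hconst]
    field_simp
  rw [hdiff, abs_mul, abs_of_pos (inv_pos.2 hh)]
  have hI : |∫ t in (s - h)..s, (deriv g t - deriv g s)| ≤ K2 * h * |s - (s - h)| := by
    have := intervalIntegral.norm_integral_le_of_norm_le_const (a := s - h) (b := s) (C := K2 * h)
      (f := fun t => deriv g t - deriv g s) fun t ht => by
        rw [Real.norm_eq_abs]
        refine (hlip t).trans (mul_le_mul_of_nonneg_left ?_ ((abs_nonneg _).trans (hK2 0)))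
        rw [uIoc_of_le (by linarith)] at ht
        rw [abs_le]; constructor <;> linarith [ht.1, ht.2]
    rw [Real.norm_eq_abs] at this
    exact this
  rw [sub_sub_cancel, abs_of_pos hh] at hI
  calc h⁻¹ * |∫ t in (s - h)..s, (deriv g t - deriv g s)| ≤ h⁻¹ * (K2 * h * h) :=
        mul_le_mul_of_nonneg_left hI (inv_nonneg.2 hh.le)
    _ = K2 * h := by field_simp

/-- **`|∫h⁻¹(g(x₂) − g(x₂−h))ρ − ∫g′(x₂)ρ| ≤ K₂h∫|ρ|`** for `ρ ∈ L¹`, `g ∈ C²`, `|g″| ≤ K₂`, `h > 0`. [folklore] -/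
theorem abs_integral_backwardQuotient_weight_sub_le (hg : ContDiff ℝ 2 g) {K1 K2 : ℝ} (hK1 : ∀ s, |deriv g s| ≤ K1)
    (hK2 : ∀ s, |deriv (deriv g) s| ≤ K2) (hρ : Integrable ρ (volume : Measure (EuclideanSpace ℝ (Fin 3))))
    {h : ℝ} (hh : 0 < h) :
    |(∫ x, h⁻¹ * (g (x 2) - g (x 2 - h)) * ρ x) - ∫ x, deriv g (x 2) * ρ x| ≤ K2 * h * ∫ x, |ρ x| := by
  have hgc : Continuous g := hg.continuous
  have hg'c : Continuous (deriv g) := hg.continuous_deriv (by norm_num)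
  have c2 : Continuous fun x : EuclideanSpace ℝ (Fin 3) => x 2 := PiLp.continuous_apply 2 _ (2 : Fin 3)
  -- the quotient weight is bounded by `K₁` (mean value), so both integrands are integrable
  have hq : ∀ s, |h⁻¹ * (g s - g (s - h))| ≤ K1 := by
    intro s
    have hgd : Differentiable ℝ g := hg.differentiable two_ne_zero
    have h1 : ∫ t in (s - h)..s, deriv g t = g s - g (s - h) :=
      intervalIntegral.integral_eq_sub_of_hasDerivAt (fun t _ => (hgd t).hasDerivAt) (hg'c.intervalIntegrable _ _)
    have := intervalIntegral.norm_integral_le_of_norm_le_const (a := s - h) (b := s) (C := K1) (f := fun t => deriv g t)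
      fun t _ => by rw [Real.norm_eq_abs]; exact hK1 t
    rw [h1, Real.norm_eq_abs, sub_sub_cancel, abs_of_pos hh] at this
    rw [abs_mul, abs_of_pos (inv_pos.2 hh)]
    calc h⁻¹ * |g s - g (s - h)| ≤ h⁻¹ * (K1 * h) := mul_le_mul_of_nonneg_left this (inv_nonneg.2 hh.le)
      _ = K1 := by field_simp
  have i1 : Integrable (fun x : EuclideanSpace ℝ (Fin 3) => h⁻¹ * (g (x 2) - g (x 2 - h)) * ρ x) volume := by
    refine (hρ.norm.const_mul K1).mono' ?_ (Eventually.of_forall fun x => ?_)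
    · exact ((continuous_const.mul ((hgc.comp c2).sub (hgc.comp (c2.sub continuous_const)))).aestronglyMeasurable).mul hρ.1
    · rw [Real.norm_eq_abs, abs_mul, Real.norm_eq_abs]
      exact mul_le_mul_of_nonneg_right (hq _) (abs_nonneg _)
  have i2 : Integrable (fun x : EuclideanSpace ℝ (Fin 3) => deriv g (x 2) * ρ x) volume := by
    refine (hρ.norm.const_mul K1).mono' (((hg'c.comp c2).aestronglyMeasurable).mul hρ.1) (Eventually.of_forall fun x => ?_)
    rw [Real.norm_eq_abs, abs_mul, Real.norm_eq_abs]
    exact mul_le_mul_of_nonneg_right (hK1 _) (abs_nonneg _)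
  rw [← integral_sub i1 i2]
  have hpt : ∀ x : EuclideanSpace ℝ (Fin 3), |h⁻¹ * (g (x 2) - g (x 2 - h)) * ρ x - deriv g (x 2) * ρ x| ≤ K2 * h * |ρ x| := by
    intro x
    rw [← sub_mul, abs_mul]
    exact mul_le_mul_of_nonneg_right (abs_backwardQuotient_sub_deriv_le hg hK2 hh _) (abs_nonneg _)
  have iK : Integrable (fun x : EuclideanSpace ℝ (Fin 3) => K2 * h * |ρ x|) volume :=
    (hρ.norm.const_mul (K2 * h)).congr (Eventually.of_forall fun x => by simp only [Real.norm_eq_abs])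
  calc |∫ x, (h⁻¹ * (g (x 2) - g (x 2 - h)) * ρ x - deriv g (x 2) * ρ x)|
      ≤ ∫ x, |h⁻¹ * (g (x 2) - g (x 2 - h)) * ρ x - deriv g (x 2) * ρ x| := abs_integral_le_integral_abs
    _ ≤ ∫ x, K2 * h * |ρ x| := integral_mono_of_nonneg (Eventually.of_forall fun x => abs_nonneg _) iK
        (Eventually.of_forall hpt)
    _ = K2 * h * ∫ x, |ρ x| := integral_const_mul _ _

/-- **`∫h⁻¹(g(x₂) − g(x₂−h))ρ → ∫g′(x₂)ρ`** as `h → 0⁺`, for `ρ ∈ L¹`, `g ∈ C²` with `g′, g″` bounded. [folklore] -/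
theorem tendsto_integral_backwardQuotient_weight (hg : ContDiff ℝ 2 g) {K1 K2 : ℝ} (hK1 : ∀ s, |deriv g s| ≤ K1)
    (hK2 : ∀ s, |deriv (deriv g) s| ≤ K2) (hρ : Integrable ρ (volume : Measure (EuclideanSpace ℝ (Fin 3)))) :
    Tendsto (fun h : ℝ => ∫ x, h⁻¹ * (g (x 2) - g (x 2 - h)) * ρ x) (𝓝[>] 0) (𝓝 (∫ x, deriv g (x 2) * ρ x)) := by
  rw [← tendsto_sub_nhds_zero_iff]
  have hb : Tendsto (fun h : ℝ => K2 * h * ∫ x, |ρ x|) (𝓝[>] 0) (𝓝 0) := by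
    have h1 : Tendsto (fun h : ℝ => K2 * h * ∫ x, |ρ x|) (𝓝 0) (𝓝 (K2 * 0 * ∫ x, |ρ x|)) :=
      ((tendsto_id.const_mul K2).mul_const _)
    rw [mul_zero, zero_mul] at h1
    exact h1.mono_left nhdsWithin_le_nhds
  refine squeeze_zero_norm' ?_ hb
  filter_upwards [eventually_mem_nhdsWithin] with h hh
  rw [Real.norm_eq_abs]
  exact abs_integral_backwardQuotient_weight_sub_le hg hK1 hK2 hρ hh

end ExtremiserLiouville

end Summit.NavierStokesRegularity.NavierStokesRegularity.Theorems

end
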